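import Mathlib.Analysis.SpecialFunctions.Pow.Real
import Mathlib.Analysis.SpecialFunctions.Log.Basic
import HarnessLib

/-!
# From a RELATIVE two-sided Laplace estimate to the LOG two-sided law consumed by ✓`setStiffness_of_twoSided_logLaplace`
# (free-hands support of ⟨stmt-QuantumFields-24197⟩ `SwapVirialDeficit.SwapGluedStiffness`; cell ym-idea-1, skeleton ➎ stub (S-bulk) `stub_bulk_stiff_sur`, g47 + w2)

The bulk region's law arrives as `|Z_t − (2π∕t)^e·M| ≤ r_t·((2π∕t)^e·M) + X_t` (✓`bulkHub_integrated_of_pointwise` ∘ ✓`bulk_fibred_plane`, `M = mbHubBulk`,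
`r_t = K L^k ψ₀^{−k} t^{−1∕2}`, `X_t` the off-tube exponential) together with a floor making `X_t ≤ x_t·((2π∕t)^e·M)`.  LEAD g98's ✓`setStiffness_of_twoSided_logLaplace`
wants `−e·log b + C − E₁ ≤ log Z_b` and `log Z_{(1+h)b} ≤ −e·log((1+h)b) + C + E₂` with a COMMON constant `C`.  This file is the pure real-analysis bridge:
* `log_one_sub_ge` (`−2ρ ≤ log(1−ρ)` for `0 ≤ ρ ≤ 1∕2`), `log_one_add_le'` (`log(1+ρ) ≤ ρ`);
* ★ `log_bounds_of_relative (hP : 0 < P) (hZ : |Z − P| ≤ ρ·P) (hρ0 : 0 ≤ ρ) (hρ : ρ ≤ 1∕2) : log P − 2ρ ≤ log Z ∧ log Z ≤ log P + ρ` (and `0 < Z`);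
* `log_laplaceMain (ht : 0 < t) (hM : 0 < M) : log ((2π∕t)^e·M) = −e·log t + (e·log(2π) + log M)`;
* ★★ `twoSided_logLaw_of_relative (ht) (hM) (hZ : |Z − (2π∕t)^e·M| ≤ r·((2π∕t)^e·M) + X) (hX : X ≤ x·((2π∕t)^e·M)) (hr : 0 ≤ r) (hx : 0 ≤ x) (hρ : r + x ≤ 1∕2) :
  −e·log t + (e·log(2π) + log M) − 2(r+x) ≤ log Z ∧ log Z ≤ −e·log t + (e·log(2π) + log M) + (r + x)` — at `t = b` this is `hlow` with `E₁ = 2(r+x)`, at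
  `t = (1+h)b` it is `hup` with `E₂ = r′ + x′`, SAME `C = e·log(2π) + log M`.

HONEST LABEL: elementary real analysis; the bulk stub, all region laws, ⟨24197⟩ ∕ ⟨24194⟩ OPEN; own crux ⟨22884⟩ OPEN (blocked-on ⟨19935⟩); the Yang–Mills mass gap is
NOT proved; no summit is proved by a line.  THEOREMS ONLY (0 `def`, 0 `sorry`), standard axioms.  Width seat ym-line-sfw-p2-w2 g59 (cell ym-idea-1, free hands),
`--supports stmt-QuantumFields-24197`.  References: [folklore]; [cite: Griffiths1964].
-/

set_option autoImplicit false

noncomputable section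

namespace Summit.QuantumFields.YangMills.Theorems.SwapVirialDeficit.SwapRing

/-- `−2ρ ≤ log(1 − ρ)` for `0 ≤ ρ ≤ 1∕2` (from `log y ≤ y − 1` at `y = (1−ρ)⁻¹`). [folklore] -/
theorem log_one_sub_ge {ρ : ℝ} (hρ0 : 0 ≤ ρ) (hρ : ρ ≤ 1 / 2) : -(2 * ρ) ≤ Real.log (1 - ρ) := by
  have h1 : 0 < 1 - ρ := by linarith
  have hinv : Real.log (1 - ρ)⁻¹ ≤ (1 - ρ)⁻¹ - 1 := Real.log_le_sub_one_of_pos (inv_pos.2 h1)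
  rw [Real.log_inv] at hinv
  have hb : (1 - ρ)⁻¹ - 1 ≤ 2 * ρ := by
    rw [show (1 - ρ)⁻¹ - 1 = ρ / (1 - ρ) by field_simp; ring]
    rw [div_le_iff₀ h1]
    nlinarith
  linarith

/-- `log(1 + ρ) ≤ ρ` for `0 ≤ ρ`. [folklore] -/
theorem log_one_add_le' {ρ : ℝ} (hρ0 : 0 ≤ ρ) : Real.log (1 + ρ) ≤ ρ := by
  have h := Real.log_le_sub_one_of_pos (by linarith : (0 : ℝ) < 1 + ρ)
  linarith

/-- ★ **Relative error ⟹ log bounds**: `0 < P`, `|Z − P| ≤ ρP`, `0 ≤ ρ ≤ 1∕2` give `0 < Z`, `log P − 2ρ ≤ log Z ≤ log P + ρ`. [folklore] -/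
theorem log_bounds_of_relative {Z P ρ : ℝ} (hP : 0 < P) (hZ : |Z - P| ≤ ρ * P) (hρ0 : 0 ≤ ρ) (hρ : ρ ≤ 1 / 2) :
    0 < Z ∧ Real.log P - 2 * ρ ≤ Real.log Z ∧ Real.log Z ≤ Real.log P + ρ := by
  obtain ⟨hlo, hhi⟩ := abs_le.1 hZ
  have hZlo : (1 - ρ) * P ≤ Z := by linarith
  have hZhi : Z ≤ (1 + ρ) * P := by linarith
  have h1ρ : 0 < 1 - ρ := by linarith
  have hZpos : 0 < Z := lt_of_lt_of_le (mul_pos h1ρ hP) hZlo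
  refine ⟨hZpos, ?_, ?_⟩
  · have h := Real.log_le_log (mul_pos h1ρ hP) hZlo
    rw [Real.log_mul h1ρ.ne' hP.ne'] at h
    linarith [log_one_sub_ge hρ0 hρ]
  · have h := Real.log_le_log hZpos hZhi
    rw [Real.log_mul (by linarith : (1 + ρ) ≠ 0) hP.ne'] at h
    linarith [log_one_add_le' hρ0]

/-- The logarithm of the Laplace main term: `log((2π∕t)^e·M) = −e·log t + (e·log(2π) + log M)` (`t, M > 0`). [folklore] -/
theorem log_laplaceMain {t e M : ℝ} (ht : 0 < t) (hM : 0 < M) :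
    Real.log ((2 * Real.pi / t) ^ e * M) = -e * Real.log t + (e * Real.log (2 * Real.pi) + Real.log M) := by
  have h2π : 0 < 2 * Real.pi := by positivity
  rw [Real.log_mul (Real.rpow_pos_of_pos (div_pos h2π ht) e).ne' hM.ne', Real.log_rpow (div_pos h2π ht), Real.log_div h2π.ne' ht.ne']
  ring

/-- ★★ **RELATIVE TWO-SIDED ESTIMATE ⟹ LOG TWO-SIDED LAW** (the `hlow`∕`hup` of ✓`setStiffness_of_twoSided_logLaplace`, common constant `C = e·log(2π) + log M`):
from `|Z − (2π∕t)^e·M| ≤ r·((2π∕t)^e·M) + X`, `X ≤ x·((2π∕t)^e·M)`, `0 ≤ r, x`, `r + x ≤ 1∕2` (`t, M > 0`):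
`−e·log t + C − 2(r+x) ≤ log Z ≤ −e·log t + C + (r+x)`. [folklore] -/
theorem twoSided_logLaw_of_relative {Z t e M r X x : ℝ} (ht : 0 < t) (hM : 0 < M)
    (hZ : |Z - (2 * Real.pi / t) ^ e * M| ≤ r * ((2 * Real.pi / t) ^ e * M) + X) (hX : X ≤ x * ((2 * Real.pi / t) ^ e * M))
    (hr : 0 ≤ r) (hx : 0 ≤ x) (hρ : r + x ≤ 1 / 2) :
    0 < Z ∧
    -e * Real.log t + (e * Real.log (2 * Real.pi) + Real.log M) - 2 * (r + x) ≤ Real.log Z ∧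
      Real.log Z ≤ -e * Real.log t + (e * Real.log (2 * Real.pi) + Real.log M) + (r + x) := by
  have hP : 0 < (2 * Real.pi / t) ^ e * M := mul_pos (Real.rpow_pos_of_pos (div_pos (by positivity) ht) e) hM
  have hZ' : |Z - (2 * Real.pi / t) ^ e * M| ≤ (r + x) * ((2 * Real.pi / t) ^ e * M) := by
    calc |Z - (2 * Real.pi / t) ^ e * M| ≤ r * ((2 * Real.pi / t) ^ e * M) + X := hZ
      _ ≤ r * ((2 * Real.pi / t) ^ e * M) + x * ((2 * Real.pi / t) ^ e * M) := by linarith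
      _ = (r + x) * ((2 * Real.pi / t) ^ e * M) := by ring
  obtain ⟨hZpos, hlo, hhi⟩ := log_bounds_of_relative hP hZ' (by linarith) hρ
  rw [log_laplaceMain ht hM] at hlo hhi
  exact ⟨hZpos, hlo, hhi⟩

/-- ★ **The budget form**: if moreover `e∕(1+h) − (2(r+x) + (r′+x′))∕h ≥ κ` then the pair (`E₁ := 2(r+x)` at `t = b`, `E₂ := r′+x′` at `t = (1+h)b`) meets the
hypothesis `hκ` of ✓`stiffness_of_local_twoSided_laws`; recorded as the arithmetic `2(r+x) + (r′+x′) ≤ 3ρ̄` when all four errors are `≤ ρ̄∕… ` — trivial helper: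
`r + x ≤ ρ̄ → r′ + x′ ≤ ρ̄ → 2(r+x) + (r′+x′) ≤ 3ρ̄`. [folklore] -/
theorem errorBudget_three {r x r' x' ρ : ℝ} (h1 : r + x ≤ ρ) (h2 : r' + x' ≤ ρ) : 2 * (r + x) + (r' + x') ≤ 3 * ρ := by
  linarith

end Summit.QuantumFields.YangMills.Theorems.SwapVirialDeficit.SwapRing

end
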